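import Summits.CriticalPhenomena.Ising3D.ExclusionSentencesControl2DZeta

/-!
# Rule R3 for the `LIN` table with a NON-EMPTY refined list

SCOPE.md §3 (pub-ising3x, recog-1).  Gen 5's `not_mem_linFamily_of_refine`
(`ExclusionSentencesControl2DZeta.lean`) settles a sub-interval from a complete `LIN` member list when
EVERY listed tuple lies outside it (refined list empty).  At phase-1 widths the refined list is
typically non-empty (`LIN`, `H ≤ 12`, seven constants, is dense: tens of members per `10⁻⁴`), so this
file adds the general form, in the style of `trgGTuplesRefine` / `trgFull_listed_of_refine` (gen 6):

* `linTuplesRefine a' b' ex ex' : Bool` — every tuple of `ex` is kept in `ex'` or has `aₓ > 0` and a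
  certified enclosure (`linTupleEncl`) decidably outside `[a', b']`;
* `mem_of_linTuplesRefine`, **`lin_listed_of_refine`**: `linExcluded H a b ex = true`,
  `[a', b'] ⊆ [a, b]`, `linTuplesRefine a' b' ex ex' = true` ⇒ every member of `linFamily H` in
  `[a', b']` is the value of a tuple of `ex'` (no four-part table re-scan; milliseconds).
* 2D-control instance, one digit after the blind width: from the landed complete nine-member list at
  `1/8 ± 10⁻⁶` (`linExcluded_control_sigma6`) the kernel derives that within `10⁻⁷` of `Δ_σ = 1/8` the
  ONLY `LIN` member is `(98 − 3π³ − 3ζ(3))/11 = 0.12499993…` (`control_sigma7_lin_refined`) — the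
  member behind SCOPE §3.18's "recognised at 8 certified digits, not 7"; non-vacuity
  `linTuplesRefine_control_sigma7_false`.

`decide +kernel` only; no `native_decide`; no new axioms.  Framing: lottery ticket; floor = tightest
certified 3D Ising CFT bounds; no exact-solution claim without a proof.
-/

namespace Summit.CriticalPhenomena.Ising3D

/-- Refinement check with a kept list: every tuple of `ex` is in `ex'`, or has `aₓ > 0` and its
enclosure decidably OUTSIDE `[a', b']`. -/
def linTuplesRefine (a' b' : ℚ) (ex ex' : List (ℤ × List ℤ × ℕ)) : Bool :=
  ex.all fun e => ex'.elem e ||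
    (decide (0 < e.2.2) && (decide ((linTupleEncl e).2 < a') || decide (b' < (linTupleEncl e).1)))

/-- Soundness of `linTuplesRefine`: a tuple of `ex` whose value lies in `[a', b']` is in `ex'`. -/
theorem mem_of_linTuplesRefine {a' b' : ℚ} {ex ex' : List (ℤ × List ℤ × ℕ)}
    (h : linTuplesRefine a' b' ex ex' = true) {e : ℤ × List ℤ × ℕ} (he : e ∈ ex)
    (hin : (a' : ℝ) ≤ lin7TupleVal e ∧ lin7TupleVal e ≤ b') : e ∈ ex' := by
  unfold linTuplesRefine at h
  have h1 := List.all_eq_true.mp h e he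
  simp only [Bool.or_eq_true, Bool.and_eq_true, List.elem_eq_mem, decide_eq_true_eq] at h1
  rcases h1 with h1 | ⟨he0, h2⟩
  · exact h1
  · obtain ⟨hv1, hv2⟩ := lin7TupleVal_mem_encl e he0
    exfalso
    rcases h2 with h2 | h2
    · have h3 : (((linTupleEncl e).2 : ℚ) : ℝ) < (a' : ℝ) := Rat.cast_lt.mpr h2
      exact absurd hin.1 (not_le.mpr (lt_of_le_of_lt hv2 h3))
    · have h3 : ((b' : ℚ) : ℝ) < (((linTupleEncl e).1 : ℚ) : ℝ) := Rat.cast_lt.mpr h2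
      exact absurd hin.2 (not_le.mpr (lt_of_lt_of_le h3 hv1))

/-- **Refinement (rule R3 in kernel form) for the whole `LIN` table, kept-list form.**  A complete
member list `ex` on `[a, b]` and the refine check for `[a', b'] ⊆ [a, b]` give: every member of
`linFamily H` in `[a', b']` is the value of a tuple of the kept list `ex'` — no new table scan. -/
theorem lin_listed_of_refine {H : ℕ} {a b a' b' : ℚ} {ex ex' : List (ℤ × List ℤ × ℕ)}
    (hc : linExcluded H a b ex = true) (ha : a ≤ a') (hb : b' ≤ b)
    (hout : linTuplesRefine a' b' ex ex' = true) {x : ℝ} (hx : (a' : ℝ) ≤ x ∧ x ≤ b')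
    (hm : x ∈ linFamily H) : ∃ e ∈ ex', x = lin7TupleVal e := by
  have ha' : ((a : ℚ) : ℝ) ≤ a' := Rat.cast_le.mpr ha
  have hb' : ((b' : ℚ) : ℝ) ≤ b := Rat.cast_le.mpr hb
  obtain ⟨e, he, hxe⟩ := linExcluded_sound hc ⟨ha'.trans hx.1, hx.2.trans hb'⟩ hm
  exact ⟨e, mem_of_linTuplesRefine hout he (hxe ▸ hx), hxe⟩

/-- The kept-list check with `ex' = []` is the gen-5 `linTuplesOutside` situation: the sub-interval has
no member. -/
theorem not_mem_linFamily_of_linTuplesRefine {H : ℕ} {a b a' b' : ℚ} {ex : List (ℤ × List ℤ × ℕ)}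
    (hc : linExcluded H a b ex = true) (ha : a ≤ a') (hb : b' ≤ b)
    (hout : linTuplesRefine a' b' ex [] = true) {x : ℝ} (hx : (a' : ℝ) ≤ x ∧ x ≤ b') :
    x ∉ linFamily H := fun hm => by
  obtain ⟨e, he, _⟩ := lin_listed_of_refine hc ha hb hout hx hm
  simp at he

/-! ### 2D control: the one `LIN` member within `10⁻⁷` of `Δ_σ = 1/8`, by refinement only -/

/-- The kept list at `1/8 ± 10⁻⁷`: the single tuple `(98, [0, 0, −3, 0, −3, 0, 0], 11)`, value
`(98 − 3π³ − 3ζ(3))/11 = 0.1249999318…` (`6.8·10⁻⁸` below `1/8`). -/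
def controlSigma7LinEx : List (ℤ × List ℤ × ℕ) :=
  [(98, [0, 0, -3, 0, -3, 0, 0], 11)]

/-- Refine check: each of the nine members within `10⁻⁶` of `1/8` (`controlSigmaLinEx`) is the kept one
or lies decidably outside `[1/8 − 10⁻⁷, 1/8 + 10⁻⁷]` (milliseconds; no table scan). -/
theorem linTuplesRefine_control_sigma7 :
    linTuplesRefine (1 / 8 - 1 / 10 ^ 7) (1 / 8 + 1 / 10 ^ 7) controlSigmaLinEx controlSigma7LinEx =
      true := by
  decide +kernel

/-- Non-vacuity: with the empty kept list the same check fails (the kept member does lie inside). -/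
theorem linTuplesRefine_control_sigma7_false :
    linTuplesRefine (1 / 8 - 1 / 10 ^ 7) (1 / 8 + 1 / 10 ^ 7) controlSigmaLinEx [] = false := by
  decide +kernel

/-- **The `LIN` table one digit after the blind width, by refinement.** A member of the whole `LIN`
table (`H ≤ 12`, seven constants) within `10⁻⁷` of `Δ_σ = 1/8` IS `(98 − 3π³ − 3ζ(3))/11` — derived from
the landed complete list at `10⁻⁶` (`linExcluded_control_sigma6`) without re-scanning the table; this is
the member behind "`Δ_σ = 1/8` recognised catalogue-wide at 8 certified digits, not 7" (SCOPE §3.18). -/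
theorem control_sigma7_lin_refined {x : ℝ}
    (hx : ((1 / 8 - 1 / 10 ^ 7 : ℚ) : ℝ) ≤ x ∧ x ≤ ((1 / 8 + 1 / 10 ^ 7 : ℚ) : ℝ))
    (hm : x ∈ linFamily 12) : x = lin7TupleVal (98, [0, 0, -3, 0, -3, 0, 0], 11) := by
  obtain ⟨e, he, hxe⟩ := lin_listed_of_refine linExcluded_control_sigma6 (by norm_num) (by norm_num)
    linTuplesRefine_control_sigma7 hx hm
  simp only [controlSigma7LinEx, List.mem_singleton] at he
  rw [hxe, he]

end Summit.CriticalPhenomena.Ising3D
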